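import Literature.NumberTheory.EllipticCurves.LocalKummerIsotropyTransport
import Literature.NumberTheory.EllipticCurves.SelmerGaloisAction
import HarnessLib

/-!
# Route `AdditiveKolyvaginRoad`, crux `LevelKolyvaginSystemsAdditive` (item stmt-BirchSwinnertonDyer-21396, KS′):
# registered stub `stub_torsionIsoBaseChange` of line `epsilon_matched_retyping`, PROVED — a `Γ_ℚ`-isomorphism
# `E[p](ℚ̄) ≃ E₀[p](ℚ̄)` read in `K̄`: a `Γ_K`-isomorphism `E₀[p](K̄) ≃ E[p](K̄)` commuting with a lift of complex conjugation
# (cell `pub/bsd-wall`, width seat `bsd-wall-akr-p2x-w3` g4; `--supports stmt-BirchSwinnertonDyer-21396`; namespace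
# `…Theorems.AdditiveKoly`)

WHY. The transfer socket (`nonempty_levelKolyvaginSystemP_of_torsionCongr_tamagawa`, p598377) is fed a `Γ_K`-equivariant
`θ : E₀[p](K̄) ≃ E[p](K̄)` commuting with the chosen lift `τ` of `c ∈ Gal(K/ℚ)` (binders `θ`, `hθ`, `hθτ`); the line
`epsilon_matched_retyping` (crux-plan, 2026-08-28) starts from the natural datum — a `Γ_ℚ`-equivariant isomorphism of the torsion
POINTS over `ℚ̄` (the certificate shape `TorsionIso`) — and asks, as its stub θ, for the `K̄`-reading. Folklore (Serre, Galois
Cohomology I §2.4): `Aut_ℚ(K̄)` is generated by `Γ_K` and one lift of `c`, and any two `ℚ`-embeddings `ℚ̄ → K̄` differ by an element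
of `Γ_ℚ`.

WHAT.
* §1 `exists_absGal_rat_closureEmb_comp` — for a lift `τ` of `c` there is `τ' ∈ Aut(ℚ̄/ℚ)` with `τ ∘ ι = ι ∘ τ'` for the chosen
  `ι : ℚ̄ → K̄` (tree `exists_algHom_eq_comp`); `pointsMap_comm_of_closureEmb_comp` — hence on points `τ (ι_* Q) = ι_* (τ' Q)`
  (`pointsMapOfEmb_comp`, `Affine.Point.map_map`); `torsionMap_torsionTransferEquiv` — the same through the tree's torsion
  transfer `torsionTransferEquiv : E[n](ℚ̄) ≃ (E⁄K)[n](K̄)`: `τ (T R) = T (τ' R)`.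
* §2 **`stub_torsionIsoBaseChange`** (VERBATIM registered signature): given `e : E[p](ℚ̄) ≃ E₀[p](ℚ̄)` `Γ_ℚ`-equivariant,
  `θ := T_E ∘ e⁻¹ ∘ T_{E₀}⁻¹` (levels `p` and `p ^ 1` identified by `AddEquiv.addSubgroupCongr`) is `Γ_K`-equivariant
  (`torsionTransferEquiv_smul`, `Γ_K → Γ_ℚ` by `absGaloisRestrict`) and commutes with `τ` on both sides (§1 with the SAME `τ'`
  for `E` and `E₀`, and `e⁻¹ τ' = τ' e⁻¹`).

HONEST FRAMING: theorems only; 0 definitions, 0 named facts, 0 `sorry`; pure Galois bookkeeping; closes ONE E-side stub of the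
line (its open content — the lender's level system S₀, the bottom transfer (A2), the `K_𝔭 ≃ ℚ_p` half of (θK)ₚ — is untouched).
BSD is not proved by any of this.

References: [cite: SerreGaloisCohomology1997, I §2.4, II §1.1] [cite: GrossLMS1991, §5 (5.1)] [cite: SilvermanAEC2009, VIII.§1].
-/

-- single-conjunct summit: `Summit.BirchSwinnertonDyer.BirchSwinnertonDyer.…` repeats the name by design
set_option linter.dupNamespace false

noncomputable section

open scoped Classical

namespace Summit.BirchSwinnertonDyer.BirchSwinnertonDyer.Theorems.AdditiveKoly

open WeierstrassCurve NumberField IsDedekindDomain Field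
  Literature.NumberTheory.EllipticCurves Literature.NumberTheory.GaloisRepresentations

variable {K : Type} [Field K] [NumberField K] {c : K ≃ₐ[ℚ] K} {τ : AlgebraicClosure K ≃+* AlgebraicClosure K}

/-! ## §1 A lift of `c` to `K̄` is induced by an element of `Γ_ℚ` along the chosen `ℚ̄ → K̄` -/

/-- **A lift `τ` of `c ∈ Aut(K/ℚ)` to `K̄` is induced by an element of `Γ_ℚ`**: for the chosen `ℚ`-embedding `ι : ℚ̄ → K̄`
there is `τ' ∈ Aut(ℚ̄/ℚ)` with `τ ∘ ι = ι ∘ τ'` (any two `ℚ`-embeddings `ℚ̄ → K̄` differ by an automorphism of `ℚ̄`; tree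
`exists_algHom_eq_comp`). [cite: SerreGaloisCohomology1997, II §1.1] -/
theorem exists_absGal_rat_closureEmb_comp (hτ : IsLiftOfAut c τ) :
    ∃ τ' : AlgebraicClosure ℚ ≃ₐ[ℚ] AlgebraicClosure ℚ,
      hτ.algEquiv.toAlgHom.comp (closureEmb (K := ℚ) K) =
        (closureEmb (K := ℚ) K).comp (τ' : AlgebraicClosure ℚ →ₐ[ℚ] AlgebraicClosure ℚ) :=
  exists_algHom_eq_comp (closureEmb (K := ℚ) K) _

/-- On points: `τ (ι_* Q) = ι_* (τ' • Q)` for `Q ∈ E(ℚ̄)` (`E = X/ℚ`; both sides are `Point.map (τ ∘ ι) = Point.map (ι ∘ τ')`).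
[cite: SilvermanAEC2009, VIII.§1] -/
theorem pointsMap_comm_of_closureEmb_comp (hτ : IsLiftOfAut c τ) {τ' : AlgebraicClosure ℚ ≃ₐ[ℚ] AlgebraicClosure ℚ}
    (hτ' : hτ.algEquiv.toAlgHom.comp (closureEmb (K := ℚ) K) =
        (closureEmb (K := ℚ) K).comp (τ' : AlgebraicClosure ℚ →ₐ[ℚ] AlgebraicClosure ℚ))
    (X : WeierstrassCurve ℚ) (Q : geomPoints X) :
    hτ.pointsMap X (show geomPoints (X.baseChange K) from pointsMap X K Q) =
      (show geomPoints (X.baseChange K) from pointsMap X K ((show absoluteGaloisGroup ℚ from τ') • Q)) := by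
  have h := congrArg (fun f ↦ f Q) (pointsMapOfEmb_comp X (closureEmb (K := ℚ) K) τ')
  change WeierstrassCurve.Affine.Point.map _ (WeierstrassCurve.Affine.Point.map _ Q) = _
  rw [WeierstrassCurve.Affine.Point.map_map, hτ']
  exact h

/-- Torsion level: `τ (T R) = T (τ' • R)` for the tree's torsion transfer `T = torsionTransferEquiv : X[n](ℚ̄) ≃ (X⁄K)[n](K̄)` and
the action `torsionMap` of the lift `τ` on `(X⁄K)[n](K̄)`. [cite: SerreGaloisCohomology1997, I §2.4] -/
theorem torsionMap_torsionTransferEquiv (hτ : IsLiftOfAut c τ) {τ' : AlgebraicClosure ℚ ≃ₐ[ℚ] AlgebraicClosure ℚ}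
    (hτ' : hτ.algEquiv.toAlgHom.comp (closureEmb (K := ℚ) K) =
        (closureEmb (K := ℚ) K).comp (τ' : AlgebraicClosure ℚ →ₐ[ℚ] AlgebraicClosure ℚ))
    (X : WeierstrassCurve ℚ) [X.IsElliptic] {n : ℤ} (hn : n ≠ 0) (R : geomTorsion X n) :
    hτ.torsionMap X n (X.torsionTransferEquiv (E := K) hn R) =
      X.torsionTransferEquiv (E := K) hn ((show absoluteGaloisGroup ℚ from τ') • R) := by
  apply Subtype.ext
  rw [IsLiftOfAut.coe_torsionMap, coe_torsionTransferEquiv_apply, coe_torsionTransferEquiv_apply,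
    AddSubgroup.torsionBy.coe_smul]
  exact pointsMap_comm_of_closureEmb_comp hτ hτ' X (R : geomPoints X)

/-! ## §3 The registered stub `stub_torsionIsoBaseChange` of line `epsilon_matched_retyping` -/

-- the registered signature names the binder `hθ` inside `∃`; keep it verbatim
set_option linter.unusedVariables false in
/-- **`stub_torsionIsoBaseChange` — registered stub θ of line `epsilon_matched_retyping` (skeleton
`Cruxes/LevelKolyvaginSystemsAdditive/Lines/epsilon_matched_retyping.lean`), VERBATIM signature, PROVED.** A `Γ_ℚ`-equivariant
isomorphism `e : E[p](ℚ̄) ≃ E₀[p](ℚ̄)` read in `K̄`: the `Γ_K`-equivariant `θ : E₀[p](K̄) ≃ E[p](K̄)`,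
`θ := T_E ∘ e⁻¹ ∘ T_{E₀}⁻¹` along the tree's torsion transfers, commuting with the action `torsionMap` of ANY lift `τ` of `c`
(both `T`'s intertwine `τ` with the SAME `τ' ∈ Γ_ℚ`, and `e` commutes with `τ'`). Feeds the binders `θ`, `hθ`, `hθτ` of the
transfer socket `nonempty_levelKolyvaginSystemP_of_torsionCongr_tamagawa` (p598377). [cite: SerreGaloisCohomology1997, I §2.4,
II §1.1] [cite: GrossLMS1991, §5 (5.1)] -/
theorem stub_torsionIsoBaseChange (W W₀ : WeierstrassCurve ℚ) [W.IsElliptic] [W₀.IsElliptic] (p : ℕ) [Fact p.Prime]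
    (K : Type) [Field K] [NumberField K] (c : K ≃ₐ[ℚ] K) {τ : AlgebraicClosure K ≃+* AlgebraicClosure K}
    (hτ : IsLiftOfAut c τ) (e : geomTorsion W (p : ℤ) ≃+ geomTorsion W₀ (p : ℤ))
    (he : ∀ (σ : absoluteGaloisGroup ℚ) (P : geomTorsion W (p : ℤ)), e (σ • P) = σ • e P) :
    ∃ (θ : geomTorsion (W₀.baseChange K) ((p ^ 1 : ℕ) : ℤ) ≃+ geomTorsion (W.baseChange K) ((p ^ 1 : ℕ) : ℤ))
      (hθ : ∀ (g : absoluteGaloisGroup K) (P : geomTorsion (W₀.baseChange K) ((p ^ 1 : ℕ) : ℤ)), θ (g • P) = g • θ P),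
      ∀ P : geomTorsion (W₀.baseChange K) ((p ^ 1 : ℕ) : ℤ),
        θ (hτ.torsionMap W₀ ((p ^ 1 : ℕ) : ℤ) P) = hτ.torsionMap W ((p ^ 1 : ℕ) : ℤ) (θ P) := by
  have hp : p.Prime := Fact.out
  have hn : ((p ^ 1 : ℕ) : ℤ) ≠ 0 := by exact_mod_cast pow_ne_zero 1 hp.ne_zero
  have hlev : ((p ^ 1 : ℕ) : ℤ) = (p : ℤ) := by simp
  -- the level transport `E[p^1] = E[p]` (equal subgroups of `E(ℚ̄)`)
  let eW : geomTorsion W ((p ^ 1 : ℕ) : ℤ) ≃+ geomTorsion W (p : ℤ) := AddEquiv.addSubgroupCongr (by rw [hlev])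
  let eW₀ : geomTorsion W₀ ((p ^ 1 : ℕ) : ℤ) ≃+ geomTorsion W₀ (p : ℤ) := AddEquiv.addSubgroupCongr (by rw [hlev])
  let e' : geomTorsion W ((p ^ 1 : ℕ) : ℤ) ≃+ geomTorsion W₀ ((p ^ 1 : ℕ) : ℤ) := eW.trans (e.trans eW₀.symm)
  have he' : ∀ (σ : absoluteGaloisGroup ℚ) (x : geomTorsion W ((p ^ 1 : ℕ) : ℤ)), e' (σ • x) = σ • e' x := by
    intro σ x
    have h1 : eW (σ • x) = σ • eW x := Subtype.ext rfl
    apply Subtype.ext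
    change ((e (eW (σ • x)) : geomTorsion W₀ (p : ℤ)) : geomPoints W₀) = ((σ • eW₀.symm (e (eW x)) : _) : geomPoints W₀)
    rw [h1, he]
    rfl
  have he's : ∀ (σ : absoluteGaloisGroup ℚ) (y : geomTorsion W₀ ((p ^ 1 : ℕ) : ℤ)), e'.symm (σ • y) = σ • e'.symm y := by
    intro σ y
    apply e'.injective
    rw [e'.apply_symm_apply, he', e'.apply_symm_apply]
  -- the torsion transfers `E[n](ℚ̄) ≃ (E⁄K)[n](K̄)` and the isomorphism `θ`
  let TW := W.torsionTransferEquiv (E := K) hn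
  let TW₀ := W₀.torsionTransferEquiv (E := K) hn
  let θ : geomTorsion (W₀.baseChange K) ((p ^ 1 : ℕ) : ℤ) ≃+ geomTorsion (W.baseChange K) ((p ^ 1 : ℕ) : ℤ) :=
    (TW₀.symm.trans e'.symm).trans TW
  have hθapply : ∀ P, θ P = TW (e'.symm (TW₀.symm P)) := fun _ ↦ rfl
  -- the lift `τ` is induced by some `τ' ∈ Γ_ℚ` along `ℚ̄ → K̄`
  obtain ⟨τ', hτ'⟩ := exists_absGal_rat_closureEmb_comp hτ
  refine ⟨θ, fun g P ↦ ?_, fun P ↦ ?_⟩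
  · rw [hθapply, hθapply, torsionTransferEquiv_symm_smul, he's, torsionTransferEquiv_smul]
  · rw [hθapply, hθapply]
    set Q₀ := TW₀.symm P with hQ₀
    have hP : P = TW₀ Q₀ := (TW₀.apply_symm_apply P).symm
    rw [hP, torsionMap_torsionTransferEquiv hτ hτ' W₀ hn Q₀, AddEquiv.symm_apply_apply, he's,
      torsionMap_torsionTransferEquiv hτ hτ' W hn]

end Summit.BirchSwinnertonDyer.BirchSwinnertonDyer.Theorems.AdditiveKoly

end
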